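import Summits.NavierStokesRegularity.NavierStokesRegularity.Theorems.FrequencyRigidity.Negative.RSSWall
import Literature.Analysis.FluidPDE.IsometryInvariance
import Literature.Analysis.FluidPDE.MildSolutionProofs
import HarnessLib

/-!
# Crux `FrequencyRigidity` (stmt-NavierStokesRegularity-2955), wall engine, stub S5
# `stub_coRotatingKernel` — file 1/3: screw-scaling push-forward of adapted kernels

Helper file (lands `--supports stmt-NavierStokesRegularity-2955`; theorems only) for the registered
stub `stub_coRotatingKernel` (co-rotating adapted kernels for rotated-self-similar drifts, the
hypothesis `H(α)` of the wall `Negative/RSSWall.lean`).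

The rotated-self-similar field `v = rss α U` (Pineau–Vicol 2026 (1.7), the tree's `pvAnsatz α`
with an `s`-independent profile) is invariant under the one-parameter group of SCREW-SCALINGS
`g_c`, `c > 0`: `v (c²t, R_c (c x)) = c⁻¹ R_c v(t,x)`, `R_c = rotZ (−2α log c)` (`rss_screw`, from the
tree's `isRotatedDSS_pvAnsatz`).  Consequently the push-forward
`(g_c K)(t,x) = c³ K(c²t, R_c (c x))` of an adapted backward kernel `K` of `v` on `(−∞,0)` with pole
`(0,0)` (`IsAdaptedBackwardKernel`) is again one (`isAdaptedBackwardKernel_screw`: chain rule for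
`∂ₜ` and `D`, `Δ(f ∘ cR) = c² (Δf) ∘ cR` for the linear isometry `R`, parabolic change of variables
and rotation invariance of Lebesgue measure for the unit mass and the concentration clause), and the
two-sided Gaussian bounds of the crux are INVARIANT under `g_c` (`screw_gaussian`,
`screw_bounds`).  Files 2/3 (`…CoRotatingKernelAverage`) and 3/3 (`…CoRotatingKernel`) average over
the discrete subgroups `{g_{e^{k h}}}` and extract invariant kernels.

## References

* B. Pineau, V. Vicol, arXiv:2607.09619 (2026), §1.2 (1.7), p. 3 (RSS invariance). [PineauVicol2026]
* A. Friedman, *Partial Differential Equations of Parabolic Type* (1964), Ch. 1 §8 (adjoint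
  fundamental solutions). [Friedman1964]
-/

noncomputable section

set_option linter.dupNamespace false

namespace Summit.NavierStokesRegularity.NavierStokesRegularity.Theorems.FrequencyRigidity.MovingAdjointBernoulli

open Literature.Analysis.FluidPDE
open Summit.NavierStokesRegularity.NavierStokesRegularity.Theorems.FrequencyRigidity.Negative
open MeasureTheory Set Filter Topology Function
open scoped Laplacian InnerProductSpace RealInnerProductSpace ContDiff

/-! ### Rotations about the axis: three one-liners -/

/-- Rotations about the axis are linear: `R_θ (a y) = a R_θ y`. -/
theorem rotZ_smul_vec' (θ a : ℝ) (y : E3) : rotZ θ (a • y) = a • rotZ θ y := by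
  rw [← rotZL_apply, map_smul, rotZL_apply]

/-- `R_{−θ} R_θ = 1`. -/
theorem rotZ_neg_rotZ' (θ : ℝ) (y : E3) : rotZ (-θ) (rotZ θ y) = y := by
  rw [← rotZ_add, neg_add_cancel, rotZ_zero]

/-- `R_θ 0 = 0`. -/
theorem rotZ_zero_vec' (θ : ℝ) : rotZ θ (0 : E3) = 0 := by
  rw [← rotZL_apply, map_zero]

/-! ### The screw-scaling symmetry of RSS fields -/

/-- **Screw-scaling symmetry of the RSS field** (Pineau–Vicol 2026, p. 3: an RSS field is
discretely self-similar with every factor `c > 0` up to the rotation by `2α log c`):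
`v(c²t, R_c(c x)) = c⁻¹ R_c v(t, x)` with `R_c = R_{−2α log c}`, `v = rss α U`. -/
theorem rss_screw (α : ℝ) (U : E3 → E3) {c : ℝ} (hc : 0 < c) (t : ℝ) (x : E3) :
    rss α U (c ^ 2 * t) (rotZ (-(α * (2 * Real.log c))) (c • x)) =
      c⁻¹ • rotZ (-(α * (2 * Real.log c))) (rss α U t x) := by
  have h := PineauVicol2026.isRotatedDSS_pvAnsatz (α := α) (U := fun y _ => U y) hc (fun _ _ => rfl) t x
  simp only [rotZLIE_symm_apply, rotZLIE_apply, neg_neg] at h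
  change pvAnsatz α (fun y _ => U y) (c ^ 2 * t) (rotZ (-(α * (2 * Real.log c))) (c • x)) =
    c⁻¹ • rotZ (-(α * (2 * Real.log c))) (pvAnsatz α (fun y _ => U y) t x)
  rw [← h]
  simp only [rotZ_smul_vec', rotZ_neg_rotZ', smul_smul, inv_mul_cancel₀ hc.ne', one_smul]

/-! ### Change of variables `y = R(c x)` in space integrals; the Gaussian bounds are invariant -/

/-- `∫ f(R_{−θ}(c x)) dx = c⁻³ ∫ f` for `c > 0` (parabolic scaling of the Bochner integral and
rotation invariance of Lebesgue measure; no integrability needed). -/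
theorem integral_comp_rotZ_smul {c : ℝ} (hc : 0 < c) (θ : ℝ) (f : E3 → ℝ) :
    ∫ x, f (rotZ (-θ) (c • x)) = (c ^ 3)⁻¹ * ∫ y, f y := by
  have h1 : (fun x : E3 => f (rotZ (-θ) (c • x))) =
      fun x : E3 => (fun z : E3 => f (rotZ (-θ) z)) (c • x) := rfl
  rw [h1, Measure.integral_comp_smul volume (fun z : E3 => f (rotZ (-θ) z)) c]
  simp only [finrank_euclideanSpace_fin, smul_eq_mul]
  have hmp : MeasurePreserving (rotZLIE (-θ) : E3 → E3) volume volume :=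
    (rotZLIE (-θ)).measurePreserving
  have hcomp : ∫ z, f (rotZ (-θ) z) = ∫ y, f y :=
    hmp.integral_comp (rotZLIE (-θ)).toHomeomorph.measurableEmbedding f
  rw [abs_of_pos (inv_pos.2 (pow_pos hc 3)), hcomp]

/-- **The Gaussians of the crux are screw-invariant**:
`c³ · C₁(−c²t)^{−3/2} exp(−‖R(cx)‖²/(C₂(−c²t))) = C₁(−t)^{−3/2} exp(−‖x‖²/(C₂(−t)))`. -/
theorem screw_gaussian {c : ℝ} (hc : 0 < c) (C₁ C₂ θ : ℝ) {t : ℝ} (ht : t < 0) (x : E3) :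
    c ^ 3 * (C₁ * ((0:ℝ) - c ^ 2 * t) ^ (-(3:ℝ) / 2) *
        Real.exp (-(‖rotZ (-θ) (c • x) - (0 : E3)‖ ^ 2) / (C₂ * ((0:ℝ) - c ^ 2 * t)))) =
      C₁ * ((0:ℝ) - t) ^ (-(3:ℝ) / 2) * Real.exp (-(‖x - (0 : E3)‖ ^ 2) / (C₂ * ((0:ℝ) - t))) := by
  have ht' : 0 < (0:ℝ) - t := by linarith
  have hc3 : c ^ 3 ≠ 0 := pow_ne_zero 3 hc.ne'
  have hpow : ((0:ℝ) - c ^ 2 * t) ^ (-(3:ℝ) / 2) = (c ^ 3)⁻¹ * ((0:ℝ) - t) ^ (-(3:ℝ) / 2) := by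
    rw [show (0:ℝ) - c ^ 2 * t = c ^ 2 * (0 - t) by ring, Real.mul_rpow (by positivity) ht'.le]
    congr 1
    rw [← Real.rpow_two, ← Real.rpow_mul hc.le, show (2:ℝ) * (-(3:ℝ) / 2) = -(3:ℝ) by norm_num,
      Real.rpow_neg hc.le, show (3:ℝ) = ((3:ℕ):ℝ) by norm_num, Real.rpow_natCast]
  have hexp : -(‖rotZ (-θ) (c • x) - (0 : E3)‖ ^ 2) / (C₂ * ((0:ℝ) - c ^ 2 * t)) =
      -(‖x - (0 : E3)‖ ^ 2) / (C₂ * ((0:ℝ) - t)) := by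
    rw [sub_zero, sub_zero, norm_rotZ, norm_smul, Real.norm_of_nonneg hc.le, mul_pow,
      show C₂ * ((0:ℝ) - c ^ 2 * t) = c ^ 2 * (C₂ * (0 - t)) by ring,
      show -((c ^ 2) * ‖x‖ ^ 2) = c ^ 2 * (-(‖x‖ ^ 2)) by ring,
      mul_div_mul_left _ _ (pow_ne_zero 2 hc.ne')]
  rw [hpow, hexp]
  field_simp

/-- **Screw-invariance of the two-sided bounds**: if `K` lies between the two Gaussians of the
crux on `(−∞,0)`, so does `g_c K = c³ K(c²·, R(c ·))`. -/
theorem screw_bounds {K : ℝ → E3 → ℝ} {c θ c₁ c₂ C₁ C₂ : ℝ} (hc : 0 < c)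
    (hb : ∀ t ∈ Iio (0:ℝ), ∀ x,
      c₁ * ((0:ℝ) - t) ^ (-(3:ℝ) / 2) * Real.exp (-(‖x - (0 : E3)‖ ^ 2) / (c₂ * ((0:ℝ) - t))) ≤
          K t x ∧
        K t x ≤
          C₁ * ((0:ℝ) - t) ^ (-(3:ℝ) / 2) * Real.exp (-(‖x - (0 : E3)‖ ^ 2) / (C₂ * ((0:ℝ) - t)))) :
    ∀ t ∈ Iio (0:ℝ), ∀ x,
      c₁ * ((0:ℝ) - t) ^ (-(3:ℝ) / 2) * Real.exp (-(‖x - (0 : E3)‖ ^ 2) / (c₂ * ((0:ℝ) - t))) ≤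
          c ^ 3 * K (c ^ 2 * t) (rotZ (-θ) (c • x)) ∧
        c ^ 3 * K (c ^ 2 * t) (rotZ (-θ) (c • x)) ≤
          C₁ * ((0:ℝ) - t) ^ (-(3:ℝ) / 2) * Real.exp (-(‖x - (0 : E3)‖ ^ 2) / (C₂ * ((0:ℝ) - t))) := by
  intro t ht x
  have hs : c ^ 2 * t ∈ Iio (0:ℝ) := mul_neg_of_pos_of_neg (pow_pos hc 2) ht
  obtain ⟨h1, h2⟩ := hb _ hs (rotZ (-θ) (c • x))
  have hc3 : 0 < c ^ 3 := pow_pos hc 3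
  refine ⟨?_, ?_⟩
  · rw [← screw_gaussian hc c₁ c₂ θ ht x]
    exact mul_le_mul_of_nonneg_left h1 hc3.le
  · rw [← screw_gaussian hc C₁ C₂ θ ht x]
    exact mul_le_mul_of_nonneg_left h2 hc3.le

/-! ### The push-forward of an adapted kernel under a symmetry of the drift -/

/-- **Push-forward of adapted kernels under screw-scalings.**  If the drift `v` has the symmetry
`v(c²t, R(cx)) = c⁻¹ R v(t,x)` (`R = R_{−θ}`, `c > 0`; for `v = rss α U` take `θ = 2α log c`,
`rss_screw`) and `K` is an adapted backward kernel of `∂ₜ + v·∇ − νΔ` on `(−∞,0)` with pole `(0,0)`,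
then so is `(g_c K)(t,x) = c³ K(c²t, R(cx))`: joint `C²` by composition; positivity; the adjoint
equation by the chain rule (`∂ₜ ↦ c⁵ ∂ₜK`, `D(g_cK)·v = c⁴ DK·(R v) = c⁵ DK·v∘g` by the symmetry,
`Δ(g_cK) = c⁵ ΔK∘g` since `x ↦ R(cx)` is `c`·(linear isometry)); unit mass and concentration at
`(0,0)` by the change of variables `y = R(cx)` (`integral_comp_rotZ_smul`) — the test function
`y ↦ φ(c⁻¹R⁻¹y)` is again bounded continuous with the same value at `0`, and `t ↦ c²t` maps
`𝓝[<] 0` to itself. -/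
theorem isAdaptedBackwardKernel_screw {ν : ℝ} {v : ℝ → E3 → E3} {K : ℝ → E3 → ℝ} {c θ : ℝ}
    (hc : 0 < c) (hv : ∀ t x, v (c ^ 2 * t) (rotZ (-θ) (c • x)) = c⁻¹ • rotZ (-θ) (v t x))
    (hK : IsAdaptedBackwardKernel ν v (Iio 0) 0 0 K) :
    IsAdaptedBackwardKernel ν v (Iio 0) 0 0
      (fun t x => c ^ 3 * K (c ^ 2 * t) (rotZ (-θ) (c • x))) where
  contDiffOn := by
    have hΦ : ContDiff ℝ 2 (fun p : ℝ × E3 => (c ^ 2 * p.1, rotZ (-θ) (c • p.2))) :=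
      (contDiff_const.mul contDiff_fst).prodMk
        ((rotZLIE (-θ)).contDiff.comp (contDiff_snd.const_smul c))
    have hmaps : MapsTo (fun p : ℝ × E3 => (c ^ 2 * p.1, rotZ (-θ) (c • p.2)))
        (Iio (0:ℝ) ×ˢ (univ : Set E3)) (Iio (0:ℝ) ×ˢ (univ : Set E3)) := by
      rintro ⟨t, x⟩ ⟨ht, -⟩
      exact ⟨mul_neg_of_pos_of_neg (pow_pos hc 2) ht, mem_univ _⟩
    have h := hK.contDiffOn.comp hΦ.contDiffOn hmaps
    exact contDiffOn_const.mul h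
  pos t ht x := mul_pos (pow_pos hc 3) (hK.pos _ (mul_neg_of_pos_of_neg (pow_pos hc 2) ht) _)
  adjoint_eq t ht x := by
    have hs : c ^ 2 * t ∈ Iio (0:ℝ) := mul_neg_of_pos_of_neg (pow_pos hc 2) ht
    have hadj := hK.adjoint_eq (c ^ 2 * t) hs (rotZ (-θ) (c • x))
    -- (a) the time derivative
    have hKt : HasDerivAt (fun σ => K σ (rotZ (-θ) (c • x)))
        (timeDerivWithin (Iio 0) K (c ^ 2 * t) (rotZ (-θ) (c • x))) (c ^ 2 * t) := by
      rw [timeDerivWithin_apply, derivWithin_of_mem_nhds (Iio_mem_nhds hs)]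
      exact ((hK.differentiableWithinAt_time hs _).differentiableAt (Iio_mem_nhds hs)).hasDerivAt
    have h1 : HasDerivAt (fun τ : ℝ => c ^ 2 * τ) (c ^ 2) t := by
      simpa using (hasDerivAt_id t).const_mul (c ^ 2)
    have h2 : HasDerivAt (fun τ => c ^ 3 * K (c ^ 2 * τ) (rotZ (-θ) (c • x)))
        (c ^ 3 * (timeDerivWithin (Iio 0) K (c ^ 2 * t) (rotZ (-θ) (c • x)) * c ^ 2)) t :=
      (hKt.comp t h1).const_mul (c ^ 3)
    have hT : timeDerivWithin (Iio 0) (fun t x => c ^ 3 * K (c ^ 2 * t) (rotZ (-θ) (c • x))) t x =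
        c ^ 3 * (timeDerivWithin (Iio 0) K (c ^ 2 * t) (rotZ (-θ) (c • x)) * c ^ 2) := by
      rw [timeDerivWithin_apply, derivWithin_of_mem_nhds (Iio_mem_nhds ht)]
      exact h2.deriv
    -- (b) the drift term
    have hKs2 : ContDiff ℝ 2 (K (c ^ 2 * t)) := hK.contDiff_slice hs
    have hKd : DifferentiableAt ℝ (K (c ^ 2 * t)) (rotZ (-θ) (c • x)) :=
      (hKs2.differentiable two_ne_zero) _
    have hin : HasFDerivAt (fun z : E3 => rotZ (-θ) (c • z))
        ((rotZL (-θ)).comp (c • ContinuousLinearMap.id ℝ E3)) x :=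
      (rotZL (-θ)).hasFDerivAt.comp x ((hasFDerivAt_id x).const_smul c)
    have hF : HasFDerivAt (fun z : E3 => c ^ 3 * K (c ^ 2 * t) (rotZ (-θ) (c • z)))
        (c ^ 3 • (fderiv ℝ (K (c ^ 2 * t)) (rotZ (-θ) (c • x))).comp
          ((rotZL (-θ)).comp (c • ContinuousLinearMap.id ℝ E3))) x :=
      (hKd.hasFDerivAt.comp x hin).const_mul (c ^ 3)
    have hvx : rotZ (-θ) (v t x) = c • v (c ^ 2 * t) (rotZ (-θ) (c • x)) := by
      rw [hv t x, smul_inv_smul₀ hc.ne']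
    have hX : fderiv ℝ (fun z : E3 => c ^ 3 * K (c ^ 2 * t) (rotZ (-θ) (c • z))) x (v t x) =
        c ^ 3 * (c ^ 2 * fderiv ℝ (K (c ^ 2 * t)) (rotZ (-θ) (c • x))
          (v (c ^ 2 * t) (rotZ (-θ) (c • x)))) := by
      rw [hF.fderiv]
      simp only [FunLike.coe_smul, Pi.smul_apply, ContinuousLinearMap.comp_apply,
        ContinuousLinearMap.id_apply, rotZL_apply, smul_eq_mul]
      rw [rotZ_smul_vec' (-θ) c (v t x), hvx, smul_smul, ← pow_two, map_smul, smul_eq_mul]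
    -- (c) the Laplacian
    have hg₁ : ContDiff ℝ 2 (fun z : E3 => K (c ^ 2 * t) (rotZ (-θ) z)) :=
      hKs2.comp (rotZLIE (-θ)).contDiff
    have hL : (Δ (fun z : E3 => c ^ 3 * K (c ^ 2 * t) (rotZ (-θ) (c • z)))) x =
        c ^ 3 * (c ^ 2 * (Δ (K (c ^ 2 * t))) (rotZ (-θ) (c • x))) := by
      have e1 : (fun z : E3 => c ^ 3 * K (c ^ 2 * t) (rotZ (-θ) (c • z))) =
          c ^ 3 • (fun z : E3 => (fun w : E3 => K (c ^ 2 * t) (rotZ (-θ) w)) (c • z)) := by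
        funext z
        simp only [Pi.smul_apply, smul_eq_mul]
      have hga : ContDiffAt ℝ 2 (fun z : E3 => (fun w : E3 => K (c ^ 2 * t) (rotZ (-θ) w)) (c • z)) x :=
        (hg₁.comp (contDiff_const_smul c)).contDiffAt
      rw [e1, InnerProductSpace.laplacian_smul _ hga, laplacian_comp_smul hg₁ c x, smul_eq_mul,
        smul_eq_mul]
      congr 2
      exact laplacian_comp_linearIsometryEquiv_symm (rotZLIE θ) (K (c ^ 2 * t)) (c • x)
    show timeDerivWithin (Iio 0) (fun t x => c ^ 3 * K (c ^ 2 * t) (rotZ (-θ) (c • x))) t x +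
        fderiv ℝ (fun z : E3 => c ^ 3 * K (c ^ 2 * t) (rotZ (-θ) (c • z))) x (v t x) +
        ν * (Δ (fun z : E3 => c ^ 3 * K (c ^ 2 * t) (rotZ (-θ) (c • z)))) x = 0
    rw [hT, hX, hL]
    linear_combination (c ^ 5) * hadj
  integral_eq_one t ht := by
    have hs : c ^ 2 * t ∈ Iio (0:ℝ) := mul_neg_of_pos_of_neg (pow_pos hc 2) ht
    show ∫ x, c ^ 3 * K (c ^ 2 * t) (rotZ (-θ) (c • x)) = 1
    rw [integral_const_mul, integral_comp_rotZ_smul hc θ (K (c ^ 2 * t)), hK.integral_eq_one _ hs]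
    field_simp
  tendsto_integral_mul φ hφ hM := by
    obtain ⟨M, hM⟩ := hM
    have hψc : Continuous fun y : E3 => φ (c⁻¹ • rotZ θ y) :=
      hφ.comp (((rotZLIE θ).continuous).const_smul c⁻¹)
    have hψM : ∀ y : E3, |φ (c⁻¹ • rotZ θ y)| ≤ M := fun y => hM _
    have hφψ : ∀ x : E3, φ x = φ (c⁻¹ • rotZ θ (rotZ (-θ) (c • x))) := fun x => by
      rw [rotZ_rotZ_neg, inv_smul_smul₀ hc.ne']
    have key : ∀ t : ℝ, ∫ x, φ x * (c ^ 3 * K (c ^ 2 * t) (rotZ (-θ) (c • x))) =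
        ∫ y, φ (c⁻¹ • rotZ θ y) * K (c ^ 2 * t) y := by
      intro t
      have e : (fun x : E3 => φ x * (c ^ 3 * K (c ^ 2 * t) (rotZ (-θ) (c • x)))) =
          fun x : E3 => c ^ 3 * (φ (c⁻¹ • rotZ θ (rotZ (-θ) (c • x))) *
            K (c ^ 2 * t) (rotZ (-θ) (c • x))) := by
        funext x
        rw [← hφψ x]
        ring
      rw [e, integral_const_mul,
        integral_comp_rotZ_smul hc θ (fun y : E3 => φ (c⁻¹ • rotZ θ y) * K (c ^ 2 * t) y)]
      field_simp
    have hlim := hK.tendsto_integral_mul (fun y : E3 => φ (c⁻¹ • rotZ θ y)) hψc ⟨M, hψM⟩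
    rw [rotZ_zero_vec', smul_zero] at hlim
    have hsc : Tendsto (fun t : ℝ => c ^ 2 * t) (𝓝[<] 0) (𝓝[<] 0) := by
      refine tendsto_nhdsWithin_iff.2 ⟨?_, ?_⟩
      · have h : Tendsto (fun t : ℝ => c ^ 2 * t) (𝓝 0) (𝓝 (c ^ 2 * 0)) :=
          (continuous_const.mul continuous_id).tendsto (0:ℝ)
        rw [mul_zero] at h
        exact h.mono_left nhdsWithin_le_nhds
      · filter_upwards [self_mem_nhdsWithin] with t ht
        exact mul_neg_of_pos_of_neg (pow_pos hc 2) ht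
    show Tendsto (fun t => ∫ x, φ x * (c ^ 3 * K (c ^ 2 * t) (rotZ (-θ) (c • x)))) (𝓝[<] 0)
      (𝓝 (φ 0))
    exact (hlim.comp hsc).congr fun t => (key t).symm

/-- **Registered helper stub `stub_coRotatingKernel_screwPush`** (one-line signature on the crux
item; helper for `stub_coRotatingKernel`, file 1/3): the explicit-binder form of
`isAdaptedBackwardKernel_screw`. -/
theorem stub_coRotatingKernel_screwPush :
    ∀ (ν : ℝ) (v : ℝ → EuclideanSpace ℝ (Fin 3) → EuclideanSpace ℝ (Fin 3)) (K : ℝ → EuclideanSpace ℝ (Fin 3) → ℝ) (c θ : ℝ), 0 < c → (∀ (t : ℝ) (x : EuclideanSpace ℝ (Fin 3)), v (c ^ 2 * t) (Literature.Analysis.FluidPDE.rotZ (-θ) (c • x)) = c⁻¹ • Literature.Analysis.FluidPDE.rotZ (-θ) (v t x)) → Literature.Analysis.FluidPDE.IsAdaptedBackwardKernel ν v (Set.Iio 0) 0 0 K → Literature.Analysis.FluidPDE.IsAdaptedBackwardKernel ν v (Set.Iio 0) 0 0 (fun t x => c ^ 3 * K (c ^ 2 * t) (Literature.Analysis.FluidPDE.rotZ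 (-θ) (c • x))) :=
  fun _ _ _ _ _ hc hv hK => isAdaptedBackwardKernel_screw hc hv hK

end Summit.NavierStokesRegularity.NavierStokesRegularity.Theorems.FrequencyRigidity.MovingAdjointBernoulli

end
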